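import Mathlib
import Summits.Ventures.HodgeRepro.Tier4.Line4.TorusProduct

/-!
# Tier4/Line4/TorusMeasurableMul — the `MeasurableMul` binders of the (7b) assembly are theorems: multiplication on the
tori `T(𝔸)`, `T′(𝔸)`, `T_f`, `T′_f`, `T_∞`, `T′_∞` is measurable for the Borel structure induced from `G(𝔸)`

Blind re-derivation cell `pub-hodge-repro`, Tier 4 «prove the step» (README §9–§10), seat t4-L4-p1 (prover, LINE L4,
gen 5; plate-filler for the residual binders `[MeasurableMul (torusT _)] [MeasurableMul (torusT' _)]` of L2-p2's
`tailForArch_body_of_pieces` / `tailForArch_seesaw_of_pieces` and plan-4 g7's `l4_tailForArch_of_pieces(_full)` census,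
S15999 / S16020).  Tree path `lean/Summits/Ventures/HodgeRepro/Tier4/Line4/TorusMeasurableMul.lean`.  Mathlib-level; no
literature.

WHAT IS PROVED.  Under `[MeasurableSpace (GA W)] [BorelSpace (GA W)]`, each torus is a subgroup of the topological group
`G(𝔸)` with the subtype Borel structure (`Subtype.borelSpace`), so multiplication by a fixed element is continuous and hence
measurable (Mathlib's `ContinuousMul.measurableMul` for an `OpensMeasurableSpace`):
`measurableMul_torusT`, `measurableMul_torusT'`, `measurableMul_torusFin`, `measurableMul_torusFin'`,
`measurableMul_torusInf`, `measurableMul_torusInf'` — and the two-variable forms `measurableMul₂_torusT`,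
`measurableMul₂_torusT'` (second countability of `G(𝔸)` through `SecondCountableGA`, so that `(a, b) ↦ a * b` is measurable
for the product σ-algebra).  The residual binders `[MeasurableMul (torusT _)] [MeasurableMul (torusT' _)]` of the (7b)
assembly are discharged by `haveI := measurableMul_torusT W; haveI := measurableMul_torusT' W`.

Nothing here says anything about the status of the Hodge conjecture for CM abelian varieties, which is NOT proved
(HC_CM is NOT proved by anyone in this repository).
-/

set_option autoImplicit false

noncomputable section

namespace Summit.Ventures.HodgeRepro.Tier4.Line4

open Summit.Ventures.HodgeRepro.Tier4.Common Summit.Ventures.HodgeRepro.Tier4.Line1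

section TorusMeasurableMul

variable {k : Type} [Field k] [NumberField k] (W : PlaneData k) [MeasurableSpace (GA W)] [BorelSpace (GA W)]

/-- Multiplication on `T(𝔸)` is measurable (Borel structure induced from `G(𝔸)`). -/
theorem measurableMul_torusT : MeasurableMul (torusT W) := by
  haveI : BorelSpace (torusT W) := Subtype.borelSpace _
  infer_instance

/-- Multiplication on `T′(𝔸)` is measurable. -/
theorem measurableMul_torusT' : MeasurableMul (torusT' W) := by
  haveI : BorelSpace (torusT' W) := Subtype.borelSpace _
  infer_instance

/-- Multiplication on `T_f` is measurable. -/
theorem measurableMul_torusFin : MeasurableMul (torusFin W) := by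
  haveI : BorelSpace (torusT W) := Subtype.borelSpace _
  haveI : BorelSpace (torusFin W) := Subtype.borelSpace _
  infer_instance

/-- Multiplication on `T′_f` is measurable. -/
theorem measurableMul_torusFin' : MeasurableMul (torusFin' W) := by
  haveI : BorelSpace (torusT' W) := Subtype.borelSpace _
  haveI : BorelSpace (torusFin' W) := Subtype.borelSpace _
  infer_instance

/-- Multiplication on `T_∞` is measurable. -/
theorem measurableMul_torusInf : MeasurableMul (torusInf W) := by
  haveI : BorelSpace (torusT W) := Subtype.borelSpace _
  haveI : BorelSpace (torusInf W) := Subtype.borelSpace _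
  infer_instance

/-- Multiplication on `T′_∞` is measurable. -/
theorem measurableMul_torusInf' : MeasurableMul (torusInf' W) := by
  haveI : BorelSpace (torusT' W) := Subtype.borelSpace _
  haveI : BorelSpace (torusInf' W) := Subtype.borelSpace _
  infer_instance

/-- `(a, b) ↦ a * b` on `T(𝔸)` is measurable for the product σ-algebra (`G(𝔸)` second countable). -/
theorem measurableMul₂_torusT : MeasurableMul₂ (torusT W) := by
  haveI : BorelSpace (torusT W) := Subtype.borelSpace _
  haveI : SecondCountableTopology (GA W) := secondCountable_GA W
  haveI : SecondCountableTopology (torusT W) := Topology.IsEmbedding.subtypeVal.secondCountableTopology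
  infer_instance

/-- `(a, b) ↦ a * b` on `T′(𝔸)` is measurable for the product σ-algebra. -/
theorem measurableMul₂_torusT' : MeasurableMul₂ (torusT' W) := by
  haveI : BorelSpace (torusT' W) := Subtype.borelSpace _
  haveI : SecondCountableTopology (GA W) := secondCountable_GA W
  haveI : SecondCountableTopology (torusT' W) := Topology.IsEmbedding.subtypeVal.secondCountableTopology
  infer_instance

end TorusMeasurableMul

end Summit.Ventures.HodgeRepro.Tier4.Line4
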